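import Summits.BirchSwinnertonDyer.BirchSwinnertonDyer.Theorems.PrintCFramBottomClassIndexLawFiveLeFlipRungSlash
import HarnessLib

set_option autoImplicit false

/-!
# Crux `PrintCFram.BottomClassIndexLawFiveLe` (stmt-BirchSwinnertonDyer-20372), line `eisenstein-resource-bdp-line` (registry v27/v28):
# the typing of `stub_flipRung`, modular assembly, part 1 — THE CUSP MATRIX `ω₀` AND THE UNIT SOLUTIONS `y, c` EXIST
# (cell `bsd-print-cfram`, width seat `bsd-line-cfram-p1-w4` g19; THEOREMS ONLY, `--supports` 20372; BSD is not proved by any of this)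

HONEST FRAMING. Elementary number theory (Bezout); nothing here is a statement about elliptic curves or BSD; no registered stub is
closed. The slash computation T3 (`…FlipRungSlash`, `…FlipRungSlashCoeff`) is parametrised by a matrix `ω₀ = [a b; M D] ∈ SL₂(ℤ)` with
`q⁴ ∣ D`, `M ∣ (D/q²) − 1`, and by solutions `y(j), c(j)` of `b − y(j)·j·M = q²·c(j)` at the units `j` of `ℤ/q²`. For the modular
assembly of (JML⁶)/(Rung⁶) these data must EXIST for the vehicle's `M` (any `M` prime to `q`):

* `exists_flippedCusp_matrix` — for `q, M` with `gcd(q, M) = 1` there are `ω₀ ∈ SL₂(ℤ)` and `d₀` with `ω₀₁₀ = M`,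
  `ω₀₁₁ = q⁴·d₀`, `M ∣ q²d₀ − 1` (`d₀` an inverse of `q²` mod `M`, then Bezout for the coprime pair `(q⁴d₀, M)`).
* `exists_unit_solutions` — for such `ω₀` (any `b`) there are `y, c : ℤ/q² → ℤ` with `ω₀₀₁ − y(j)·j·M = q²·c(j)` at every unit `j`
  (`j·M` is invertible mod `q²`).
beyond-print theorem: NO.

References: [IrelandRosen1990] Prop. 3.3.1 (linear congruences); crux notes lead-g14 §2.1.
-/

-- summit-side namespace `Summit.BirchSwinnertonDyer.BirchSwinnertonDyer.…` (single-conjunct summit, D-0017 layout)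
set_option linter.dupNamespace false

noncomputable section

open scoped MatrixGroups Classical

namespace Summit.BirchSwinnertonDyer.BirchSwinnertonDyer.Theorems.PrintCFram.FlipRung

/-- **The cusp matrix exists.** For natural numbers `q, M` with `gcd(q, M) = 1` there are `ω₀ ∈ SL₂(ℤ)` and `d₀ ∈ ℤ` with
lower row `(M, q⁴d₀)` and `M ∣ q²d₀ − 1` — the matrix of T3's `slash_flippedCusp_decomposition` (`D = q⁴d₀ ≡ q² (mod M)`).
[cite: IrelandRosen1990, Prop. 3.3.1] -/
theorem exists_flippedCusp_matrix {q M : ℕ} (hqM : Nat.Coprime q M) :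
    ∃ (ω₀ : SL(2, ℤ)) (d₀ : ℤ), ω₀ 1 0 = M ∧ ω₀ 1 1 = (q : ℤ) ^ 4 * d₀ ∧ (M : ℤ) ∣ (q : ℤ) ^ 2 * d₀ - 1 := by
  -- `d₀` = an inverse of `q²` modulo `M`
  have hcop2 : IsCoprime ((q : ℤ) ^ 2) (M : ℤ) := (Nat.Coprime.isCoprime hqM).pow_left
  obtain ⟨u, v, huv⟩ := hcop2
  -- `u q² + v M = 1`, so `d₀ := u` has `q² d₀ ≡ 1 (mod M)`
  set d₀ : ℤ := u with hd₀
  have hd₀M : (M : ℤ) ∣ (q : ℤ) ^ 2 * d₀ - 1 := ⟨-v, by rw [hd₀]; linear_combination huv⟩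
  -- `D := q⁴ d₀` is prime to `M`
  have hcopD : IsCoprime ((q : ℤ) ^ 4 * d₀) (M : ℤ) := by
    refine IsCoprime.mul_left (Nat.Coprime.isCoprime hqM).pow_left ?_
    -- `d₀` is prime to `M`: `q² d₀ ≡ 1`
    exact ⟨(q : ℤ) ^ 2, v, by rw [hd₀]; linear_combination huv⟩
  obtain ⟨a, b', hab⟩ := hcopD
  -- `a D + b' M = 1`; take `b := -b'`
  refine ⟨⟨!![a, -b'; (M : ℤ), (q : ℤ) ^ 4 * d₀], ?_⟩, d₀, rfl, rfl, hd₀M⟩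
  rw [Matrix.det_fin_two_of]
  linear_combination hab

/-- **The unit solutions exist.** For `q ≥ 1`, an integer `M` prime to `q` and `ω₀ ∈ SL₂(ℤ)` (only its entry `b = ω₀₀₁` matters):
there are `y, c : ℤ/q² → ℤ` with `b − y(j)·j·M = q²·c(j)` at every unit `j` of `ℤ/q²` (`j` read in `[0, q²)`) — the data of T3's
`slash_flippedCusp_decomposition` (`y(j) ≡ b·(jM)⁻¹ ≡ −M̄²j̄ (mod q²)`). [cite: IrelandRosen1990, Prop. 3.3.1] -/
theorem exists_unit_solutions {q : ℕ} [NeZero (q ^ 2)] {M : ℤ} (hqM : IsCoprime (q : ℤ) M) (b : ℤ) :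
    ∃ y c : ZMod (q ^ 2) → ℤ, ∀ j : ZMod (q ^ 2), IsUnit j → b - y j * (j.val : ℤ) * M = (q : ℤ) ^ 2 * c j := by
  -- for each unit `j` solve `y·(jM) ≡ b (mod q²)`
  have key : ∀ j : ZMod (q ^ 2), IsUnit j → ∃ y c : ℤ, b - y * (j.val : ℤ) * M = (q : ℤ) ^ 2 * c := by
    intro j hj
    -- `j.val` is prime to `q`
    have hjq : IsCoprime (q : ℤ) (j.val : ℤ) := by
      rw [← ZMod.natCast_zmod_val j, ZMod.isUnit_iff_coprime] at hj
      have h1 : Nat.Coprime j.val q := (Nat.coprime_pow_right_iff (by norm_num) _ _).mp hj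
      exact (Nat.Coprime.isCoprime h1).symm
    have hcop : IsCoprime (((q : ℤ) ^ 2)) ((j.val : ℤ) * M) :=
      (IsCoprime.mul_right hjq hqM).pow_left
    obtain ⟨s, t, hst⟩ := hcop
    -- `s q² + t (jM) = 1`, so `y := b t` works with `c := b s`
    exact ⟨b * t, b * s, by linear_combination (-b) * hst⟩
  choose! y c hyc using key
  exact ⟨y, c, fun j hj ↦ hyc j hj⟩

end Summit.BirchSwinnertonDyer.BirchSwinnertonDyer.Theorems.PrintCFram.FlipRung

end
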